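import Summits.CriticalPhenomena.CardyFormulaZ2.Theorems.CardyComplexConeParafermionToSLESixFamiliesDiamondDartPhaseArcs
import Summits.CriticalPhenomena.CardyFormulaZ2.Theorems.CardyComplexConeParafermionToSLESixFamiliesDiamondDartPhaseLoop
import Summits.CriticalPhenomena.CardyFormulaZ2.Theorems.CardyComplexConeParafermionToSLESixFamiliesDiamondTurnCountGeom
import HarnessLib

/-!
# The wired test segment after the end of the free arc of a marked diamond
# (line `potential-darboux-picard-diamond`, S1p `stub_boundaryDartPhase`, part 15)

Crux `ParafermionToSLESixFamilies` (stmt-CriticalPhenomena-11389), line `potential-darboux-picard-diamond`, stub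
`stub_boundaryDartPhase` (S1p). For the counter-clockwise boundary loop `ℓ` of a marked diamond in its frame
(`exists_boundaryLoop_frame`) with `D.arc 1 = ℓ [s₁, t₁]`, `D.arc 0 = ℓ [t₁, s₁ + 2π]`, the end `b = ℓ t₁` of the free arc
lies on a side `k_b` at distance `σ_b ∈ [0, dLen)` from its start, and for a length `L > 0` with `σ_b + 4L ≤ dLen` every
piece `[σ_b + λ₁, σ_b + λ₂]` (`0 < λ₁ < λ₂ ≤ 4L`) of side `k_b` is an ORIENTED BOUNDARY SEGMENT of `D` contained in the
WIRED arc `D.arc 0` (`exists_wiredTestSegment`, registered): the segments against which the position of the start edge is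
tested. Also: the two marks are `ℓ s₁` and `ℓ t₁` (`pt_eq_or`).
-/

noncomputable section

namespace Summit.CriticalPhenomena.CardyFormulaZ2.Cruxes.ParafermionToSLESixFamilies.PotentialDarbouxPicardDiamond

open Set Metric Complex
open Literature.Probability.RandomPlanarGeometry

/-- The orientation form of a piece of side `k` against a point of the frame. -/
theorem im_orient_dParam (α β : ℝ) (k : Fin 4) (z : ℂ) (σ τ : ℝ) :
    ((z - dParam α β k σ) * (starRingEnd ℂ) (dParam α β k τ - dParam α β k σ)).im = (τ - σ) * (gam α β k - Fk k z) := by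
  rw [dParam_sub]
  fin_cases k <;> simp [dParam, dCorner, dDir, Fk, gam, Complex.mul_im] <;> ring

section Loop

variable {D : DobrushinDomain} {c : ℂ} {α β : ℝ} (hα : 0 < α) (hβ : 0 < β)
  (hcar : D.carrier = {z | |(dRot c z).re| < α ∧ |(dRot c z).im| < β}) {ℓ : ℝ → ℂ}
  (hper : ∀ s : ℝ, ℓ (s + 2 * Real.pi) = ℓ s) (hrange : Set.range ℓ = frontier D.carrier)
  (hinj : Set.InjOn ℓ (Set.Ico 0 (2 * Real.pi)))
  (hframe : ∀ (k : ℕ) (r : ℝ), 0 ≤ r → r ≤ 1 →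
    (k % 4 = 0 → dRot c (ℓ ((k + r) * (Real.pi / 2))) = dParam α β 1 (r * dLen α β 1)) ∧
    (k % 4 = 1 → dRot c (ℓ ((k + r) * (Real.pi / 2))) = dParam α β 2 (r * dLen α β 2)) ∧
    (k % 4 = 2 → dRot c (ℓ ((k + r) * (Real.pi / 2))) = dParam α β 3 (r * dLen α β 3)) ∧
    (k % 4 = 3 → dRot c (ℓ ((k + r) * (Real.pi / 2))) = dParam α β 0 (r * dLen α β 0)))
  {s₁ t₁ : ℝ} (hst : s₁ < t₁) (hts : t₁ < s₁ + 2 * Real.pi)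
  (harc1 : D.arc 1 = ℓ '' Icc s₁ t₁) (harc0 : D.arc 0 = ℓ '' Icc t₁ (s₁ + 2 * Real.pi))

include hper hinj hst hts harc1 harc0 in
/-- **The marks are the two junctions of the arcs.** -/
theorem pt_eq_or (j : Fin 2) : D.pt j = ℓ s₁ ∨ D.pt j = ℓ t₁ := by
  have h1 : D.pt j ∈ D.arc 1 := pt_mem_arc j 1
  have h0 : D.pt j ∈ D.arc 0 := pt_mem_arc j 0
  rw [harc1] at h1
  rw [harc0] at h0
  obtain ⟨u, hu, hju⟩ := h1
  obtain ⟨v, hv, hjv⟩ := h0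
  rcases hv.2.lt_or_eq with hlt | heq
  · have : u = v := loop_injOn_window hper hinj s₁ ⟨hu.1, by linarith [hu.2]⟩ ⟨by linarith [hv.1], hlt⟩ (hju.trans hjv.symm)
    subst this
    have : u = t₁ := le_antisymm hu.2 hv.1
    subst this
    exact Or.inr hju.symm
  · left
    rw [← hjv, heq, hper]

include hper in
/-- Shifting the parameter by whole periods. -/
theorem loop_add_nat_mul (t : ℝ) (m : ℕ) : ℓ (t + m * (2 * Real.pi)) = ℓ t := by
  have hp : Function.Periodic ℓ (2 * Real.pi) := hper
  exact hp.nat_mul m t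

include hframe in
/-- **The loop at a nonnegative parameter**, side and position. -/
theorem loop_at (kn : ℕ) {r : ℝ} (hr0 : 0 ≤ r) (hr1 : r ≤ 1) :
    dRot c (ℓ ((kn + r) * (Real.pi / 2))) = dParam α β (Fin.ofNat 4 (kn + 1)) (r * dLen α β (Fin.ofNat 4 (kn + 1))) := by
  obtain ⟨h0, h1, h2, h3⟩ := hframe kn r hr0 hr1
  have hm := Nat.mod_lt kn (show 0 < 4 by norm_num)
  interval_cases h : kn % 4
  · have e : Fin.ofNat 4 (kn + 1) = 1 := Fin.ext (by rw [Fin.val_ofNat]; simp; omega)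
    rw [e]; exact h0 rfl
  · have e : Fin.ofNat 4 (kn + 1) = 2 := Fin.ext (by rw [Fin.val_ofNat]; simp; omega)
    rw [e]; exact h1 rfl
  · have e : Fin.ofNat 4 (kn + 1) = 3 := Fin.ext (by rw [Fin.val_ofNat]; simp; omega)
    rw [e]; exact h2 rfl
  · have e : Fin.ofNat 4 (kn + 1) = 0 := Fin.ext (by rw [Fin.val_ofNat]; simp; omega)
    rw [e]; exact h3 rfl

include hper in
/-- **Normalising a parameter**: a nonnegative representative `(kn + r) π/2`, `r ∈ [0, 1)`, with the same loop values at
all shifts. -/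
theorem exists_norm_param (t : ℝ) :
    ∃ (kn : ℕ) (r : ℝ), 0 ≤ r ∧ r < 1 ∧ ∀ θ : ℝ, ℓ (t + θ) = ℓ ((kn + r) * (Real.pi / 2) + θ) := by
  have hπ : 0 < Real.pi / 2 := by positivity
  obtain ⟨m, hm⟩ : ∃ m : ℕ, 0 ≤ t + m * (2 * Real.pi) := by
    obtain ⟨m, hm⟩ := exists_nat_ge (-t / (2 * Real.pi))
    refine ⟨m, ?_⟩
    rw [div_le_iff₀ Real.two_pi_pos] at hm
    linarith
  set t' := t + m * (2 * Real.pi) with ht'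
  refine ⟨⌊t' / (Real.pi / 2)⌋₊, t' / (Real.pi / 2) - ⌊t' / (Real.pi / 2)⌋₊, ?_, ?_, fun θ => ?_⟩
  · have := Nat.floor_le (div_nonneg hm hπ.le); linarith
  · have := Nat.lt_floor_add_one (t' / (Real.pi / 2)); linarith
  · have e : ((⌊t' / (Real.pi / 2)⌋₊ : ℝ) + (t' / (Real.pi / 2) - ⌊t' / (Real.pi / 2)⌋₊)) * (Real.pi / 2) + θ = (t + θ) + m * (2 * Real.pi) := by
      field_simp; rw [ht']; ring
    rw [e, loop_add_nat_mul hper]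

include hα hβ hcar hper hrange hinj hframe hst hts harc1 harc0 in
/-- **The wired test segments after the end of the free arc.** See the module docstring. -/
theorem exists_wiredTestSegment_core :
    ∃ (kb : Fin 4) (σb L : ℝ), 0 ≤ σb ∧ 0 < L ∧ σb + 4 * L ≤ dLen α β kb ∧ dRot c (ℓ t₁) = dParam α β kb σb ∧
      ∀ lam₁ lam₂ : ℝ, 0 < lam₁ → lam₁ < lam₂ → lam₂ ≤ 4 * L →
        IsBdrySegment D (dRotInv c (dParam α β kb (σb + lam₁))) (dRotInv c (dParam α β kb (σb + lam₂))) ∧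
          segment ℝ (dRotInv c (dParam α β kb (σb + lam₁))) (dRotInv c (dParam α β kb (σb + lam₂))) ⊆ D.arc 0 := by
  have hπ : 0 < Real.pi / 2 := by positivity
  obtain ⟨kn, r, hr0, hr1, hshift⟩ := exists_norm_param hper t₁
  set kb : Fin 4 := Fin.ofNat 4 (kn + 1) with hkb
  have hLpos : 0 < dLen α β kb := dLen_pos hα hβ kb
  have hb : dRot c (ℓ t₁) = dParam α β kb (r * dLen α β kb) := by
    have := hshift 0
    rw [add_zero, add_zero] at this
    rw [this]; exact loop_at hframe kn hr0 hr1.le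
  -- the room after `b`: on the side and on the wired arc
  set ρ : ℝ := min (1 - r) ((s₁ + 2 * Real.pi - t₁) / (Real.pi / 2)) with hρ
  have hρpos : 0 < ρ := lt_min (by linarith) (div_pos (by linarith) hπ)
  have hρ1 : ρ ≤ 1 - r := min_le_left _ _
  have hρ2 : ρ * (Real.pi / 2) ≤ s₁ + 2 * Real.pi - t₁ := by
    have := min_le_right (1 - r) ((s₁ + 2 * Real.pi - t₁) / (Real.pi / 2))
    rwa [le_div_iff₀ hπ] at this
  -- points of the side after `b` as loop points
  have hpt : ∀ lam : ℝ, 0 ≤ lam → lam ≤ ρ * dLen α β kb →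
      dRotInv c (dParam α β kb (r * dLen α β kb + lam)) = ℓ (t₁ + lam / dLen α β kb * (Real.pi / 2)) ∧
        0 ≤ lam / dLen α β kb * (Real.pi / 2) ∧ lam / dLen α β kb * (Real.pi / 2) ≤ s₁ + 2 * Real.pi - t₁ := by
    intro lam h0 h1
    have hq0 : 0 ≤ lam / dLen α β kb := div_nonneg h0 hLpos.le
    have hq1 : lam / dLen α β kb ≤ ρ := by rw [div_le_iff₀ hLpos]; linarith
    refine ⟨?_, by positivity, by nlinarith⟩
    rw [hshift, show (kn + r) * (Real.pi / 2) + lam / dLen α β kb * (Real.pi / 2) = (kn + (r + lam / dLen α β kb)) * (Real.pi / 2) by ring]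
    have := loop_at hframe kn (r := r + lam / dLen α β kb) (by linarith) (by linarith)
    rw [← hkb] at this
    have e : (r + lam / dLen α β kb) * dLen α β kb = r * dLen α β kb + lam := by field_simp
    rw [e] at this
    rw [← this, dRotInv_dRot]
  refine ⟨kb, r * dLen α β kb, ρ * dLen α β kb / 4, by positivity, by positivity, by nlinarith, hb, ?_⟩
  intro lam₁ lam₂ h1 h12 h2
  have h2' : lam₂ ≤ ρ * dLen α β kb := by linarith
  obtain ⟨hw₁, hθ₁0, hθ₁1⟩ := hpt lam₁ h1.le (by linarith)
  obtain ⟨hw₂, hθ₂0, hθ₂1⟩ := hpt lam₂ (by linarith) h2'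
  have hp : dRot c (dRotInv c (dParam α β kb (r * dLen α β kb + lam₁))) = dParam α β kb (r * dLen α β kb + lam₁) := dRot_dRotInv c _
  have hq : dRot c (dRotInv c (dParam α β kb (r * dLen α β kb + lam₂))) = dParam α β kb (r * dLen α β kb + lam₂) := dRot_dRotInv c _
  -- points of the segment as loop points of the wired window
  have hseg : ∀ z ∈ segment ℝ (dRotInv c (dParam α β kb (r * dLen α β kb + lam₁))) (dRotInv c (dParam α β kb (r * dLen α β kb + lam₂))),
      ∃ lam : ℝ, lam₁ ≤ lam ∧ lam ≤ lam₂ ∧ z = ℓ (t₁ + lam / dLen α β kb * (Real.pi / 2)) := by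
    intro z hz
    obtain ⟨s, hs1, hs2, hzs⟩ := exists_dParam_of_mem_segment hp hq (by linarith) hz
    refine ⟨s - r * dLen α β kb, by linarith, by linarith, ?_⟩
    rw [← (hpt (s - r * dLen α β kb) (by linarith) (by linarith)).1, show r * dLen α β kb + (s - r * dLen α β kb) = s by ring,
      ← hzs, dRotInv_dRot]
  have hoff : ∀ w : ℂ, (w = ℓ s₁ ∨ w = ℓ t₁) →
      w ∉ openSegment ℝ (dRotInv c (dParam α β kb (r * dLen α β kb + lam₁))) (dRotInv c (dParam α β kb (r * dLen α β kb + lam₂))) := by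
    intro w hw hz
    rw [openSegment_eq_image_lineMap] at hz
    obtain ⟨θ, ⟨hθ0, hθ1⟩, rfl⟩ := hz
    set lam : ℝ := lam₁ + θ * (lam₂ - lam₁) with hlam
    have hl1 : lam₁ < lam := by rw [hlam]; nlinarith
    have hl2 : lam < lam₂ := by rw [hlam]; nlinarith
    have hz' : (AffineMap.lineMap (dRotInv c (dParam α β kb (r * dLen α β kb + lam₁))) (dRotInv c (dParam α β kb (r * dLen α β kb + lam₂))) θ : ℂ) =
        ℓ (t₁ + lam / dLen α β kb * (Real.pi / 2)) := by
      rw [← (hpt lam (by linarith) (by linarith)).1, ← dRotInv_lineMap, lineMap_dParam]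
      congr 2; rw [hlam]; ring
    rw [hz'] at hw
    have hτ0 : 0 < lam / dLen α β kb * (Real.pi / 2) := by have := div_pos (h1.trans hl1) hLpos; positivity
    have hτ1 : lam / dLen α β kb * (Real.pi / 2) < s₁ + 2 * Real.pi - t₁ := by
      have : lam / dLen α β kb * (Real.pi / 2) < lam₂ / dLen α β kb * (Real.pi / 2) := by
        have := div_lt_div_of_pos_right hl2 hLpos; nlinarith
      linarith
    have hw1 : t₁ + lam / dLen α β kb * (Real.pi / 2) ∈ Ico t₁ (t₁ + 2 * Real.pi) := ⟨by linarith, by linarith⟩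
    rcases hw with hw | hw
    · rw [← hper s₁] at hw
      have := loop_injOn_window hper hinj t₁ hw1 ⟨by linarith, by linarith⟩ hw
      linarith
    · have := loop_injOn_window hper hinj t₁ hw1 ⟨le_rfl, by linarith [Real.two_pi_pos]⟩ hw
      linarith
  have h0off := hoff (D.pt 0) (pt_eq_or hper hinj hst hts harc1 harc0 0)
  have h1off := hoff (D.pt 1) (pt_eq_or hper hinj hst hts harc1 harc0 1)
  refine ⟨⟨?_, ?_, h0off, h1off, ?_⟩, ?_⟩
  · -- distinct endpoints
    intro h
    have := congrArg (fun z => Gk kb (dRot c z)) h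
    simp only [hp, hq, Gk_dParam] at this
    linarith
  · -- on the frontier
    intro z hz
    obtain ⟨lam, -, -, rfl⟩ := hseg z hz
    rw [← hrange]; exact mem_range_self _
  · -- orientation
    intro z hz
    rw [← orient_dRot c, hp, hq, im_orient_dParam]
    have hF := ((mem_carrier_iff_frame hcar kb z).1 hz).1
    rw [abs_lt] at hF
    exact mul_pos (by linarith) (by linarith)
  · -- inside the wired arc
    intro z hz
    obtain ⟨lam, hl1, hl2, rfl⟩ := hseg z hz
    rw [harc0]
    refine ⟨t₁ + lam / dLen α β kb * (Real.pi / 2), ⟨?_, ?_⟩, rfl⟩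
    · have : 0 ≤ lam / dLen α β kb * (Real.pi / 2) := by have := div_nonneg (h1.le.trans hl1) hLpos.le; positivity
      linarith
    · have : lam / dLen α β kb * (Real.pi / 2) ≤ lam₂ / dLen α β kb * (Real.pi / 2) := by
        have := div_le_div_of_nonneg_right hl2 hLpos.le; nlinarith
      linarith

end Loop

/-- **The wired test segments after the end of the free arc** (registered helper of `stub_boundaryDartPhase`). See the
module docstring. -/
theorem exists_wiredTestSegment : ∀ (D : DobrushinDomain) (c : ℂ) (α β : ℝ), 0 < α → 0 < β → D.carrier = {z | |((z - c) * exp (-(Real.pi / 4 : ℝ) * I)).re| < α ∧ |((z - c) * exp (-(Real.pi / 4 : ℝ) * I)).im| < β} → ∀ (ℓ : ℝ → ℂ), (∀ s : ℝ, ℓ (s + 2 * Real.pi) = ℓ s) → Set.range ℓ = frontier D.carrier → Set.InjOn ℓ (Set.Ico 0 (2 * Real.pi)) → (∀ (k : ℕ) (r : ℝ), 0 ≤ r → r ≤ 1 → (k % 4 = 0 → dRot c (ℓ ((k + r) * (Real.pi / 2))) = dParam α β 1 (r * dLen α β 1)) ∧ (k % 4 = 1 → dRot c (ℓ ((k + r)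 * (Real.pi / 2))) = dParam α β 2 (r * dLen α β 2)) ∧ (k % 4 = 2 → dRot c (ℓ ((k + r) * (Real.pi / 2))) = dParam α β 3 (r * dLen α β 3)) ∧ (k % 4 = 3 → dRot c (ℓ ((k + r) * (Real.pi / 2))) = dParam α β 0 (r * dLen α β 0))) → ∀ (s₁ t₁ : ℝ), s₁ < t₁ → t₁ < s₁ + 2 * Real.pi → D.arc 1 = ℓ '' Set.Icc s₁ t₁ → D.arc 0 = ℓ '' Set.Icc t₁ (s₁ + 2 * Real.pi) → ∃ (kb : Fin 4) (σb L : ℝ), 0 ≤ σb ∧ 0 < L ∧ σb + 4 * L ≤ dLen α β kb ∧ dRot c (ℓ t₁) = dParam α β kb σb ∧ ∀ lam₁ lam₂ : ℝ, 0 < lam₁ → lam₁ < lam₂ → lam₂ ≤ 4 * L → IsBdrySegment D (dRotInv c (dParam α β kb (σb + lam₁))) (dRotInv c (dParam α β kb (σb + lam₂))) ∧ segment ℝ (dRotInv c (dParam α β kb (σb + lam₁))) (dRotInv c (dParam α β kb (σb + lam₂))) ⊆ D.arc 0 := by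
  intro D c α β hα hβ hcar ℓ hper hrange hinj hframe s₁ t₁ hst hts harc1 harc0
  exact exists_wiredTestSegment_core hα hβ hcar hper hrange hinj hframe hst hts harc1 harc0

end Summit.CriticalPhenomena.CardyFormulaZ2.Cruxes.ParafermionToSLESixFamilies.PotentialDarbouxPicardDiamond

end
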